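import Literature.Computability.Cryptography.RegevSamplerGRLabel
import HarnessLib

/-!
# Regev 2009, Lemma 3.14 in machine form: the standard block embedding

Topic `Literature/Computability/Cryptography`, grouping namespace `Regev2009.SamplerRegs`; sequel of
`RegevSamplerGRLabel.lean` and `RegevSamplerLayoutStd.lean`. The per-block machine theorems (`RegevSamplerMachine*`)
take the placement `E : Fin n → (Fin B ↪ Fin W)` of the `n` Grover–Rudolph blocks with the hypothesis `BlocksFit`:
blocks pairwise disjoint, the point wires `ws j` of block `i` on the point-zone positions `iℓ + j`, every other block
wire in the work window. This file constructs the STANDARD EMBEDDING for any well-formed layout with room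
`base + n·B ≤ W` and any point-wire embedding `ws` sitting on the first `ℓ` block wires (`(ws j : ℕ) = j`, which is
the case for `GRData.ws`): point wires to the zone, wire `q ≥ ℓ` of block `i` to `base + iB + q`.

* `stdEmb I hΛ ws hws hroom : Fin n → (Fin B ↪ Fin W)`; `blocksFit_stdEmb : BlocksFit I Λ (stdEmb …) ws`.

Everything here is proved; no named fact is introduced.

## References

* O. Regev, *On lattices, learning with errors, random linear codes, and cryptography*, J. ACM 56 (2009),
  art. 34, Lemma 3.14 (proof), Lemma 3.12 (proof) [Regev2009].
-/

noncomputable section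

namespace Literature.Computability.Cryptography

namespace Regev2009

namespace SamplerRegs

open Literature.Algebra.EuclideanLattices Literature.Computability.QuantumComplexity SamplerClassical
  SamplerClassical.Layout _root_.Computability

variable {W B : ℕ} (I : LatticeInstance) {Λ : Layout W I.n} (hΛ : Λ.OK) (ws : Fin Λ.ℓ ↪ Fin B)
  (hws : ∀ j, (ws j : ℕ) = j) (hroom : Λ.base + I.n * B ≤ W)

/-- Block arithmetic: `iℓ + q = i'ℓ + q'` with `q, q' < ℓ` forces `i = i'`. [folklore] -/
theorem blk_index_eq {ℓ i i' q q' : ℕ} (h : i * ℓ + q = i' * ℓ + q') (hq : q < ℓ) (hq' : q' < ℓ) : i = i' := by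
  have hℓ : 0 < ℓ := by omega
  have h1 : (ℓ * i + q) / ℓ = i := by rw [Nat.mul_add_div hℓ, Nat.div_eq_of_lt hq, Nat.add_zero]
  have h2 : (ℓ * i' + q') / ℓ = i' := by rw [Nat.mul_add_div hℓ, Nat.div_eq_of_lt hq', Nat.add_zero]
  rw [← h1, ← h2, Nat.mul_comm ℓ i, Nat.mul_comm ℓ i', h]

/-- A work wire of block `i` is below `W`. [folklore] -/
theorem base_add_lt {i q : ℕ} (hi : i < I.n) (hq : q < B) (hroom : Λ.base + I.n * B ≤ W) : Λ.base + (i * B + q) < W := by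
  have : i * B + q < I.n * B :=
    calc i * B + q < i * B + B := Nat.add_lt_add_left hq _
      _ = (i + 1) * B := (Nat.succ_mul _ _).symm
      _ ≤ I.n * B := Nat.mul_le_mul_right _ hi
  omega

/-- The wire of block `i`, block wire `q`: the point-zone position `iℓ + q` if `q < ℓ`, else the work wire
`base + iB + q`. [folklore] -/
def stdEmbFun (i : Fin I.n) (q : Fin B) : Fin W :=
  if (q : ℕ) < Λ.ℓ then Λ.fin ((i : ℕ) * Λ.ℓ + q) else ⟨Λ.base + ((i : ℕ) * B + q), base_add_lt I i.2 q.2 hroom⟩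

omit hws in
include hΛ in
/-- Values of the standard wires: below the base on point wires, `base + iB + q` otherwise. [folklore] -/
theorem stdEmbFun_val_of_lt (i : Fin I.n) (q : Fin B) (hq : (q : ℕ) < Λ.ℓ) :
    (stdEmbFun I hroom i q : ℕ) < Λ.base := by
  unfold stdEmbFun; rw [if_pos hq]
  have hT := Λ.T_eq
  have hlt : (i : ℕ) * Λ.ℓ + q < I.n * Λ.ℓ := blk_lt i ⟨q, hq⟩
  have hX := hΛ.szX
  exact Layout.fin_lt_base hΛ (by omega)

omit hws in
/-- Values of the standard wires off the point wires. [folklore] -/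
theorem stdEmbFun_val_of_le (i : Fin I.n) (q : Fin B) (hq : Λ.ℓ ≤ (q : ℕ)) :
    (stdEmbFun I hroom i q : ℕ) = Λ.base + ((i : ℕ) * B + q) := by
  unfold stdEmbFun; rw [if_neg (Nat.not_lt.2 hq)]

include hΛ in
omit hws in
/-- The standard wires of one block are injective. [folklore] -/
theorem stdEmbFun_injective (i : Fin I.n) : Function.Injective (stdEmbFun I hroom i) := by
  intro q q' h
  have hT := Λ.T_eq
  have hX := hΛ.szX
  by_cases hq : (q : ℕ) < Λ.ℓ <;> by_cases hq' : (q' : ℕ) < Λ.ℓ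
  · have h1 : Λ.fin ((i : ℕ) * Λ.ℓ + q) = Λ.fin ((i : ℕ) * Λ.ℓ + q') := by
      have := h; unfold stdEmbFun at this; rwa [if_pos hq, if_pos hq'] at this
    have hlt : (i : ℕ) * Λ.ℓ + q < I.n * Λ.ℓ := blk_lt i ⟨q, hq⟩
    have hlt' : (i : ℕ) * Λ.ℓ + q' < I.n * Λ.ℓ := blk_lt i ⟨q', hq'⟩
    have := Layout.fin_inj hΛ (by omega) (by omega) h1
    exact Fin.ext (by omega)
  · have h1 := stdEmbFun_val_of_lt I hΛ hroom i q hq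
    have h2 := stdEmbFun_val_of_le I hroom i q' (Nat.not_lt.1 hq')
    rw [h] at h1; omega
  · have h1 := stdEmbFun_val_of_le I hroom i q (Nat.not_lt.1 hq)
    have h2 := stdEmbFun_val_of_lt I hΛ hroom i q' hq'
    rw [← h] at h2; omega
  · have h1 := stdEmbFun_val_of_le I hroom i q (Nat.not_lt.1 hq)
    have h2 := stdEmbFun_val_of_le I hroom i q' (Nat.not_lt.1 hq')
    rw [h] at h1; exact Fin.ext (by omega)

/-- **The standard block embedding.** [cite: Regev2009, Lemma 3.14 (proof)] -/
def stdEmb (i : Fin I.n) : Fin B ↪ Fin W := ⟨stdEmbFun I hroom i, stdEmbFun_injective I hΛ hroom i⟩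

/-- Unfolding `stdEmb`. [folklore] -/
theorem stdEmb_apply (i : Fin I.n) (q : Fin B) : stdEmb I hΛ hroom i q = stdEmbFun I hroom i q := rfl

include hws in
/-- **The standard embedding fits**: disjoint blocks, point wires on the zone, the rest in the work window.
[cite: Regev2009, Lemma 3.14 (proof)] -/
theorem blocksFit_stdEmb : BlocksFit I Λ (stdEmb I hΛ hroom) ws where
  disj := by
    intro i i' hii'
    rw [Set.disjoint_iff]
    rintro w ⟨⟨q, hq⟩, ⟨q', hq'⟩⟩
    rw [stdEmb_apply] at hq hq'
    have hT := Λ.T_eq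
    have hX := hΛ.szX
    apply hii'
    by_cases h1 : (q : ℕ) < Λ.ℓ <;> by_cases h2 : (q' : ℕ) < Λ.ℓ
    · have e : Λ.fin ((i : ℕ) * Λ.ℓ + q) = Λ.fin ((i' : ℕ) * Λ.ℓ + q') := by
        have a := hq; have b := hq'; unfold stdEmbFun at a b; rw [if_pos h1] at a; rw [if_pos h2] at b; rw [a, b]
      have hlt : (i : ℕ) * Λ.ℓ + q < I.n * Λ.ℓ := blk_lt i ⟨q, h1⟩
      have hlt' : (i' : ℕ) * Λ.ℓ + q' < I.n * Λ.ℓ := blk_lt i' ⟨q', h2⟩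
      have := Layout.fin_inj hΛ (by omega) (by omega) e
      exact Fin.ext (blk_index_eq this h1 h2)
    · have a := stdEmbFun_val_of_lt I hΛ hroom i q h1
      have b := stdEmbFun_val_of_le I hroom i' q' (Nat.not_lt.1 h2)
      rw [hq] at a; rw [hq'] at b; omega
    · have a := stdEmbFun_val_of_le I hroom i q (Nat.not_lt.1 h1)
      have b := stdEmbFun_val_of_lt I hΛ hroom i' q' h2
      rw [hq] at a; rw [hq'] at b; omega
    · have a := stdEmbFun_val_of_le I hroom i q (Nat.not_lt.1 h1)
      have b := stdEmbFun_val_of_le I hroom i' q' (Nat.not_lt.1 h2)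
      rw [hq] at a; rw [hq'] at b
      have e : (i : ℕ) * B + q = (i' : ℕ) * B + q' := by omega
      exact Fin.ext (blk_index_eq e q.2 q'.2)
  ws_eq := by
    intro i j
    rw [stdEmb_apply]
    have hj : ((ws j : Fin B) : ℕ) < Λ.ℓ := by rw [hws]; exact j.2
    unfold stdEmbFun; rw [if_pos hj]
    simp only [hws]
  off_ge := by
    intro i q hq
    rw [stdEmb_apply]
    by_cases h : (q : ℕ) < Λ.ℓ
    · exact absurd ⟨⟨q, h⟩, Fin.ext (by rw [hws])⟩ hq
    · rw [stdEmbFun_val_of_le I hroom i q (Nat.not_lt.1 h)]; omega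

end SamplerRegs

end Regev2009

end Literature.Computability.Cryptography

end
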